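import Literature.NumberTheory.Automorphic.OrbitalIntegralCentralTransport
import Literature.NumberTheory.Automorphic.UnitaryGroupSplitPlaceOrbitalIntegral
import Literature.NumberTheory.Automorphic.GLnBlockScalarOrbitalIntegral
import HarnessLib

/-!
# The split-place junction at the singular pair: `Φ^{G_v}(γ₀, 1_{K_v})` against `Φ^{H_v}(γ₀^H, 1_{K_H})` for
# `e γ₀ = diag(t₁ 1_I, t₂ 1_J)`, `t₁ ≠ t₂`, at a place `v` split in `E`
(Rogawski (1990), §4.13, Lemma 4.13.1 (a) and its proof p. 70 — the `(G, H)`-regular singular element `γ = diag(e₁, e₁, e₂)`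
with `H_γ = M = GL₂ × GL₁`, at a split place `G_v ≅ GL₃(E_w)`; Prop. 8.2.1 p. 117; Mok (2015) §1)

Topic `NumberTheory/Automorphic`; namespace `Literature.NumberTheory.Automorphic.UnitaryGroup`. THEOREMS ONLY (no definition,
no instance, no named fact, no `sorry`). Cell `pub/hodgecm-mathlib`, programme P3a, road (κ-loc-split) under row #88 (LEAD
F0P3a-plan T6-92∕T6-97 «D-S1e»): through the dictionary ★ `UnitaryGroupSplitPlaceOrbitalIntegral` («D-S1d») the GL-side singular
descent ★ `exists_integral_descConj_blockScalar_eq_smul'` («D-S1b∕c», `GLnBlockScalarOrbitalIntegral`) is read on `G_v = U(J)(F_v)` at an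
element `γ₀` whose `w`-component `e γ₀` is the block scalar `z_t = diag(t_{c′ i})` (`c′ : Fin N → Bool` monotone, `t₁ ≠ t₂`); the
`H`-side integral at the CENTRAL `γ₀^H` is the generic ★ `orbitalIntegral_quotientMeasure_eq_self_of_forall_conj_eq`
(`OrbitalIntegralCentralTransport`). Every constant is VISIBLE — the GL-side constant `C` of ★ D-S1b (depending only on the canonical
GL-side data `ν'/ρ_M`, `κ`, `μ_U` on the FIXED quotient `GL_N(E_w) ⧸ M_{c′}`), the factor `‖t₂/t₁ - 1‖_w^{-|I||J|}`, the masses of integral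
points — and NO claim is made that the quotient is a transfer factor `Δ_v`.

* `forall_mem_standardLeviGL_mul_blockScalar_comm`, `forall_localSplitEquiv_mem_standardLeviGL_iff` — `M_{c′}` centralises `z_t` and
  `e(C(γ₀)) = M_{c′}` (★ `centralizer_blockDiagonalGL_scalar_eq_standardLeviGL`): measures on `U(J)(F_v) ⧸ C(γ₀)` transport to the
  fixed `GL_N(E_w) ⧸ M_{c′}`;
* `setOf_blockScalar_mul_mem_glInt_eq` — `{u ∈ U_{c′} | z_t u ∈ GL_N(𝒪_w)} = U_{c′}(𝒪_w)` when `z_t ∈ GL_N(𝒪_w)`;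
  `integral_prod_indicator_glInt_conj_eq` — `∫_{K×U} 1_{GL_N(𝒪_w)}(k (z u) k⁻¹) = μ_U{u | z u ∈ GL_N(𝒪_w)}` for `κ(K) = 1`;
* **`exists_orbitalIntegral_comp_localSplitEquiv_eq_smul_of_eq_blockScalar`** (e1) — ONE `C ≠ 0` such that for every such `γ₀, t`, every
  `vol K_v = 1` Haar `ν`, every `ρ` on `C(γ₀)` with `(e|)_* ρ = ρ_M`, every continuous `f`:
  `Φ^{U(J)(F_v)}_{ν/ρ}(γ₀, f ∘ e) = (C ‖t₂/t₁ - 1‖_w^{-|I||J|}) • ∫_{K×U_{c′}} f(k (z_t u) k⁻¹) d(κ ⊗ μ_U)`;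
* **`exists_orbitalIntegral_indicator_eq_mul_of_eq_blockScalar`** (e1′) — `Φ^{U(J)(F_v)}_{ν/ρ}(γ₀, 1_{K_v}) = C ‖t₂/t₁ - 1‖_w^{-|I||J|} ·
  μ_U{u | z_t u ∈ GL_N(𝒪_w)}` (★ `indicator_glInt_comp_localSplitEquiv`; `= C ‖…‖^{-|I||J|}` for unit `t_a` and `μ_U(U(𝒪_w)) = 1`);
* **`exists_orbitalIntegral_indicator_div_central_eq`** (e3) — divided by the `H`-side central integral (`= 1`): the same visible
  constant. For `N = 3`, `c′ = (2, 1)`: `|I||J| = 2`, print's `|e₂/e₁ - 1|⁻²` (Rogawski p. 70).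

The hypothesis `ρ_M = (e|_{C(γ₀)})_* ρ` is kept in the ★ `map_cosetCongr_quotientMeasure` shape (its discharge from
`ρ(C(γ₀) ∩ K_v) = 1 = ρ_M(M ∩ GL_N(𝒪_w))` by uniqueness of Haar measure is ★ `map_subgroupCongrHomeomorph_apply_setOf_mem` + ★
`isHaarMeasure_eq_of_apply_eq`, left to the consumer). GL-side `LocallyCompactSpace`∕`SecondCountableTopology` are BINDERS
(★ `UnitaryGroup.locallyCompactSpace_gl_adicCompletion`, ★ `secondCountableTopology_gl_adicCompletion`); `MeasurableSpace`∕`BorelSpace`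
are hypotheses as everywhere in the tree. NOT here: non-split places; the VALUE of `C` (a Bruhat–Tits count, «D-S3»); transfer factors.

## References
* J. D. Rogawski, *Automorphic Representations of Unitary Groups in Three Variables* (1990), §4.13 Lemma 4.13.1 (a), proof p. 70;
  Prop. 8.2.1 p. 117 [Rogawski1990].
* C. P. Mok, *Endoscopic classification of representations of quasi-split unitary groups* (2015), §1 p. 5 [Mok2014].
* A. Deitmar, S. Echterhoff, *Principles of Harmonic Analysis*, 2nd ed. (2014), Thm. 1.5.3 [DeitmarEchterhoff2014].
-/

set_option autoImplicit false

noncomputable section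

open MeasureTheory Measure Set Filter Topology NumberField IsDedekindDomain Literature.MeasureTheory.Group
open scoped ENNReal NNReal Matrix MatrixGroups

namespace Literature.NumberTheory.Automorphic.UnitaryGroup

open Literature.NumberTheory.GaloisRepresentations.IsNonarchimedeanLocalField

/-! ## §3 The split singular pair: `e γ₀ = z_t = diag(t_{c′ i})`, `t₁ ≠ t₂` -/

variable {F E : Type} [Field F] [NumberField F] [Field E] [NumberField E] [Algebra F E]
  [Algebra.IsQuadraticExtension F E]
  (c : E ≃ₐ[F] E) (N : ℕ) (J : Matrix (Fin N) (Fin N) E) {v : HeightOneSpectrum (𝓞 F)}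
  (hc : c ≠ 1) (hJ : (J.map c)ᵀ = J) (w : PlacesOver E v) (hw : c • w.1 ≠ w.1)
  (hJw : IsUnit (placeForm J w.1)) {c' : Fin N → Bool}

omit [NumberField F] [Algebra.IsQuadraticExtension F E] in
/-- `t₁ ≠ t₂` in the field `E_w` means unit differences `t_a - t_b ∈ E_wˣ` for `a ≠ b` (the regularity hypothesis of ★
`centralizer_blockDiagonalGL_scalar_eq_standardLeviGL`). [folklore] -/
private theorem isUnit_sub_of_ne (t : Bool → (w.1.adicCompletion E)ˣ)
    (ht : (t false : w.1.adicCompletion E) ≠ t true) :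
    ∀ a b : Bool, a ≠ b → IsUnit ((t a : w.1.adicCompletion E) - t b) := by
  intro a b hab
  rw [isUnit_iff_ne_zero, sub_ne_zero]
  cases a <;> cases b
  · exact absurd rfl hab
  · exact ht
  · exact fun h => ht h.symm
  · exact absurd rfl hab

omit [NumberField F] [Algebra.IsQuadraticExtension F E] in
/-- The Levi subgroup `M_{c′}` centralises the block scalar `z_t`. [cite: Rogawski1990, §4.13, proof of Lemma 4.13.1, p. 70] -/
theorem forall_mem_standardLeviGL_mul_blockScalar_comm (t : Bool → (w.1.adicCompletion E)ˣ)
    (ht : (t false : w.1.adicCompletion E) ≠ t true) :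
    ∀ m ∈ standardLeviGL (w.1.adicCompletion E) c',
      m * blockDiagonalGL (w.1.adicCompletion E) c' (fun a => Matrix.GeneralLinearGroup.scalar _ (t a)) =
        blockDiagonalGL (w.1.adicCompletion E) c' (fun a => Matrix.GeneralLinearGroup.scalar _ (t a)) * m := by
  intro m hm
  rw [← centralizer_blockDiagonalGL_scalar_eq_standardLeviGL c' t (isUnit_sub_of_ne w t ht)] at hm
  exact Subgroup.mem_centralizer_singleton_iff.1 hm

/-- **`e(C(γ₀)) = M_{c′}`**: for `e γ₀ = z_t` with `t₁ ≠ t₂`, `e g ∈ M_{c′} ↔ g ∈ C(γ₀)` (★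
`centralizer_blockDiagonalGL_scalar_eq_standardLeviGL`: `C_{GL_N}(z_t) = M_{c′}`) — the compatibility hypothesis that
transports measures on `U(J)(F_v) ⧸ C(γ₀)` to the FIXED quotient `GL_N(E_w) ⧸ M_{c′}`.
[cite: Rogawski1990, §4.13, proof of Lemma 4.13.1, p. 70] -/
theorem forall_localSplitEquiv_mem_standardLeviGL_iff (t : Bool → (w.1.adicCompletion E)ˣ)
    (ht : (t false : w.1.adicCompletion E) ≠ t true) {γ₀ : «local» E c N J v}
    (hγ₀ : localSplitEquiv c J hc hJ w hw hJw γ₀ =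
      blockDiagonalGL (w.1.adicCompletion E) c' (fun a => Matrix.GeneralLinearGroup.scalar _ (t a))) :
    ∀ g : «local» E c N J v,
      (localSplitEquiv c J hc hJ w hw hJw).toMulEquiv g ∈ standardLeviGL (w.1.adicCompletion E) c' ↔
        g ∈ Subgroup.centralizer ({γ₀} : Set («local» E c N J v)) := by
  intro g
  have h := forall_apply_mem_centralizer_singleton_iff_of_eq (localSplitEquiv c J hc hJ w hw hJw).toMulEquiv hγ₀ g
  rwa [centralizer_blockDiagonalGL_scalar_eq_standardLeviGL c' t (isUnit_sub_of_ne w t ht)] at h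

omit [NumberField F] [Algebra.IsQuadraticExtension F E] in
/-- The integral points of `U_{c′}` translated by an INTEGRAL block scalar: `{u | z_t u ∈ GL_N(𝒪_w)} = U_{c′}(𝒪_w)` when
`z_t ∈ GL_N(𝒪_w)` (all `t_a ∈ 𝒪_wˣ`). [cite: Rogawski1990, §4.13, proof of Lemma 4.13.1, p. 70] -/
theorem setOf_blockScalar_mul_mem_glInt_eq (t : Bool → (w.1.adicCompletion E)ˣ)
    (hz : blockDiagonalGL (w.1.adicCompletion E) c' (fun a => Matrix.GeneralLinearGroup.scalar _ (t a)) ∈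
      glInt N (w.1.adicCompletion E)) :
    {u : ↥(unipotentRadicalGL (w.1.adicCompletion E) c') |
        blockDiagonalGL (w.1.adicCompletion E) c' (fun a => Matrix.GeneralLinearGroup.scalar _ (t a)) *
          (u : GL (Fin N) (w.1.adicCompletion E)) ∈ glInt N (w.1.adicCompletion E)} =
      {u : ↥(unipotentRadicalGL (w.1.adicCompletion E) c') |
        (u : GL (Fin N) (w.1.adicCompletion E)) ∈ glInt N (w.1.adicCompletion E)} := by
  ext u
  simp only [mem_setOf_eq, Subgroup.mul_mem_cancel_left _ hz]

section Descent

variable [MeasurableSpace (w.1.adicCompletion E)] [BorelSpace (w.1.adicCompletion E)]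
  [MeasurableSpace («local» E c N J v)] [BorelSpace («local» E c N J v)]
  [MeasurableSpace (GL (Fin N) (w.1.adicCompletion E))] [BorelSpace (GL (Fin N) (w.1.adicCompletion E))]
  [LocallyCompactSpace (GL (Fin N) (w.1.adicCompletion E))] [SecondCountableTopology (GL (Fin N) (w.1.adicCompletion E))]
  [MeasurableSpace (GL (Fin N) (w.1.adicCompletion E) ⧸ standardLeviGL (w.1.adicCompletion E) c')]
  [BorelSpace (GL (Fin N) (w.1.adicCompletion E) ⧸ standardLeviGL (w.1.adicCompletion E) c')]
  (ρM : Measure ↥(standardLeviGL (w.1.adicCompletion E) c')) [ρM.IsMulLeftInvariant] [IsFiniteMeasureOnCompacts ρM]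
  [ρM.IsOpenPosMeasure] [ρM.IsInvInvariant] [SFinite ρM]
  (ν' : Measure (GL (Fin N) (w.1.adicCompletion E))) [IsHaarMeasure ν'] [ν'.IsMulRightInvariant]
  (κ : Measure ↥(glInt N (w.1.adicCompletion E))) [IsHaarMeasure κ]
  (μU : Measure ↥(unipotentRadicalGL (w.1.adicCompletion E) c')) [IsHaarMeasure μU]

/-- **(e1) The `G`-side singular orbital integral at a split place, read through the dictionary.** Fix the CANONICAL
GL-side data: a Haar measure `ν'` on `GL_N(E_w)` with `ν'(GL_N(𝒪_w)) = 1`, a Haar measure `ρ_M` on `M_{c′}`, Haar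
measures `κ` on `K = GL_N(𝒪_w)` and `μ_U` on `U_{c′}`. There is ONE `C ≠ 0` — the constant of ★
`exists_integral_descConj_blockScalar_eq_smul'` for `ν'/ρ_M`, `κ`, `μ_U` — such that for EVERY `γ₀ ∈ U(J)(F_v)` whose
`w`-component `e γ₀` is a block scalar `z_t = diag(t_{c′ i})` with `t₁ ≠ t₂`, every Haar `ν` on `U(J)(F_v)` with
`ν(U(J)(𝒪_v)) = 1`, every Haar `ρ` on `C(γ₀)` transporting to `ρ_M` along `e| : C(γ₀) ≃ M_{c′}`, and every continuous `f`:
`Φ^{U(J)(F_v)}_{ν/ρ}(γ₀, f ∘ e) = (C ‖t₂/t₁ - 1‖_w^{-|I||J|}) • ∫_{K × U_{c′}} f(k (z_t u) k⁻¹) d(κ ⊗ μ_U)`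
(★ D-S1d + `integral_descConj_quotientMeasure_eq_of_mulEquiv` at the fixed quotient `GL_N ⧸ M_{c′}` + ★ D-S1b).
For `N = 3`, `c′ = (2,1)`, `z_t = diag(e₁, e₁, e₂)`: Rogawski's `Φ(γ, f) = C |e₂/e₁ - 1|⁻² ∫_K ∫_U f(k γ u k⁻¹)`.
[cite: Rogawski1990, §4.13, Lemma 4.13.1 (a), proof p. 70] [cite: Mok2014, §1 Notation p. 5] -/
theorem exists_orbitalIntegral_comp_localSplitEquiv_eq_smul_of_eq_blockScalar (hc' : Monotone c')
    (hM : IsClosed ((standardLeviGL (w.1.adicCompletion E) c' : Subgroup (GL (Fin N) (w.1.adicCompletion E))) :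
      Set (GL (Fin N) (w.1.adicCompletion E))))
    (hJi : hJw.unit ∈ glInt N (w.1.adicCompletion E)) (hν' : ν' (glInt N (w.1.adicCompletion E)) = 1)
    {B : Type*} [NormedAddCommGroup B] [NormedSpace ℝ B] :
    ∃ C : ℝ≥0, C ≠ 0 ∧ ∀ (γ₀ : «local» E c N J v) (t : Bool → (w.1.adicCompletion E)ˣ)
      (ht : (t false : w.1.adicCompletion E) ≠ t true)
      (hγ₀ : localSplitEquiv c J hc hJ w hw hJw γ₀ =
        blockDiagonalGL (w.1.adicCompletion E) c' (fun a => Matrix.GeneralLinearGroup.scalar _ (t a)))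
      [MeasurableSpace (↥(«local» E c N J v) ⧸ Subgroup.centralizer ({γ₀} : Set («local» E c N J v)))]
      [BorelSpace (↥(«local» E c N J v) ⧸ Subgroup.centralizer ({γ₀} : Set («local» E c N J v)))]
      (hC : IsClosed ((Subgroup.centralizer ({γ₀} : Set («local» E c N J v)) : Subgroup («local» E c N J v)) :
        Set («local» E c N J v)))
      (ρ : Measure (Subgroup.centralizer ({γ₀} : Set («local» E c N J v)))) [ρ.IsMulLeftInvariant]
      [IsFiniteMeasureOnCompacts ρ] [ρ.IsOpenPosMeasure] [ρ.IsInvInvariant] [SFinite ρ]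
      (_ : ρM = Measure.map (subgroupCongrHomeomorph (localSplitEquiv c J hc hJ w hw hJw).toMulEquiv _ _
        (forall_localSplitEquiv_mem_standardLeviGL_iff c N J hc hJ w hw hJw t ht hγ₀)
        (localSplitEquiv c J hc hJ w hw hJw).continuous (localSplitEquiv c J hc hJ w hw hJw).symm.continuous) ρ)
      (ν : Measure («local» E c N J v)) [IsHaarMeasure ν] [ν.IsMulRightInvariant]
      (_ : ν (localIntegralLevel c N J v) = 1) (f : GL (Fin N) (w.1.adicCompletion E) → B), Continuous f →
      orbitalIntegral γ₀ (f ∘ localSplitEquiv c J hc hJ w hw hJw)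
          (quotientMeasure (Subgroup.centralizer ({γ₀} : Set («local» E c N J v))) ρ hC ν) =
        ((C * normAbs (w.1.adicCompletion E)
            (((t true : w.1.adicCompletion E) * (t false : w.1.adicCompletion E)⁻¹ - 1) ^
              (Fintype.card {i : Fin N // c' i = false} * Fintype.card {j : Fin N // c' j = true}))⁻¹ : ℝ≥0) : ℝ) •
          ∫ q : ↥(glInt N (w.1.adicCompletion E)) × ↥(unipotentRadicalGL (w.1.adicCompletion E) c'),
            f ((q.1 : GL (Fin N) (w.1.adicCompletion E)) *
              (blockDiagonalGL (w.1.adicCompletion E) c' (fun a => Matrix.GeneralLinearGroup.scalar _ (t a)) *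
                (q.2 : GL (Fin N) (w.1.adicCompletion E))) *
              (q.1 : GL (Fin N) (w.1.adicCompletion E))⁻¹) ∂(κ.prod μU) := by
  haveI : IsClosed ((standardLeviGL (w.1.adicCompletion E) c' : Subgroup (GL (Fin N) (w.1.adicCompletion E))) :
      Set (GL (Fin N) (w.1.adicCompletion E))) := hM
  obtain ⟨C, hC0, h⟩ := exists_integral_descConj_blockScalar_eq_smul' (w.1.adicCompletion E) hc'
    (A := standardLeviGL (w.1.adicCompletion E) c') rfl
    (μ := quotientMeasure (standardLeviGL (w.1.adicCompletion E) c') ρM hM ν')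
    (quotientMeasure_ne_zero _ ρM hM ν') κ μU (E := B)
  refine ⟨C, hC0, ?_⟩
  intro γ₀ t ht hγ₀ _ _ hCl ρ _ _ _ _ _ hρ ν _ _ hν f hf
  have hν'e : ν' = ν.map (localSplitEquiv c J hc hJ w hw hJw) :=
    (map_localSplitEquiv_eq c N J hc hJ w hw hJw hJi ν ν' hν hν').symm
  have key := integral_descConj_quotientMeasure_eq_of_mulEquiv (localSplitEquiv c J hc hJ w hw hJw).toMulEquiv
    (localSplitEquiv c J hc hJ w hw hJw).continuous (localSplitEquiv c J hc hJ w hw hJw).symm.continuous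
    (Subgroup.centralizer ({γ₀} : Set («local» E c N J v))) (standardLeviGL (w.1.adicCompletion E) c')
    (forall_localSplitEquiv_mem_standardLeviGL_iff c N J hc hJ w hw hJw t ht hγ₀) (hH := hCl) (hH' := hM)
    ρ ρM ν ν' hρ hν'e hγ₀ (fun _ hg => Subgroup.mem_centralizer_singleton_iff.1 hg)
    (forall_mem_standardLeviGL_mul_blockScalar_comm N w t ht) f
  rw [h t ht (forall_mem_standardLeviGL_mul_blockScalar_comm N w t ht) f hf] at key
  rw [orbitalIntegral_eq_integral_descConj]
  exact key.symm

omit [NumberField F] [Algebra.IsQuadraticExtension F E] [MeasurableSpace (w.1.adicCompletion E)] [BorelSpace (w.1.adicCompletion E)]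
  [LocallyCompactSpace (GL (Fin N) (w.1.adicCompletion E))] [SecondCountableTopology (GL (Fin N) (w.1.adicCompletion E))]
  [MeasurableSpace (GL (Fin N) (w.1.adicCompletion E) ⧸ standardLeviGL (w.1.adicCompletion E) c')]
  [BorelSpace (GL (Fin N) (w.1.adicCompletion E) ⧸ standardLeviGL (w.1.adicCompletion E) c')] [IsHaarMeasure μU] in
/-- The `K × U_{c′}`-integral of `1_{GL_N(𝒪_w)}(k (z u) k⁻¹)` is `κ(K) · μ_U{u | z u ∈ GL_N(𝒪_w)}`; with `κ(K) = 1` it is that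
mass (as a complex number). [cite: Rogawski1990, §4.13, proof of Lemma 4.13.1, p. 70] -/
theorem integral_prod_indicator_glInt_conj_eq (z : GL (Fin N) (w.1.adicCompletion E)) (hκ : κ univ = 1) [SFinite μU] :
    ∫ q : ↥(glInt N (w.1.adicCompletion E)) × ↥(unipotentRadicalGL (w.1.adicCompletion E) c'),
        (glInt N (w.1.adicCompletion E) : Set (GL (Fin N) (w.1.adicCompletion E))).indicator (fun _ => (1 : ℂ))
          ((q.1 : GL (Fin N) (w.1.adicCompletion E)) * (z * (q.2 : GL (Fin N) (w.1.adicCompletion E))) *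
            (q.1 : GL (Fin N) (w.1.adicCompletion E))⁻¹) ∂(κ.prod μU) =
      ((μU {u | z * (u : GL (Fin N) (w.1.adicCompletion E)) ∈ glInt N (w.1.adicCompletion E)}).toReal : ℂ) := by
  haveI : BorelSpace ↥(unipotentRadicalGL (w.1.adicCompletion E) c') := Subtype.borelSpace _
  have hS : MeasurableSet {u : ↥(unipotentRadicalGL (w.1.adicCompletion E) c') |
      z * (u : GL (Fin N) (w.1.adicCompletion E)) ∈ glInt N (w.1.adicCompletion E)} :=
    ((isOpen_glInt N (w.1.adicCompletion E)).preimage (continuous_const.mul continuous_subtype_val)).measurableSet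
  have h1 : ∀ q : ↥(glInt N (w.1.adicCompletion E)) × ↥(unipotentRadicalGL (w.1.adicCompletion E) c'),
      (glInt N (w.1.adicCompletion E) : Set (GL (Fin N) (w.1.adicCompletion E))).indicator (fun _ => (1 : ℂ))
          ((q.1 : GL (Fin N) (w.1.adicCompletion E)) * (z * (q.2 : GL (Fin N) (w.1.adicCompletion E))) *
            (q.1 : GL (Fin N) (w.1.adicCompletion E))⁻¹) =
        {u : ↥(unipotentRadicalGL (w.1.adicCompletion E) c') |
            z * (u : GL (Fin N) (w.1.adicCompletion E)) ∈ glInt N (w.1.adicCompletion E)}.indicator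
          (fun _ => (1 : ℂ)) q.2 := fun q => by
    have hiff : (q.1 : GL (Fin N) (w.1.adicCompletion E)) * (z * (q.2 : GL (Fin N) (w.1.adicCompletion E))) *
          (q.1 : GL (Fin N) (w.1.adicCompletion E))⁻¹ ∈ glInt N (w.1.adicCompletion E) ↔
        z * (q.2 : GL (Fin N) (w.1.adicCompletion E)) ∈ glInt N (w.1.adicCompletion E) :=
      (Subgroup.mul_mem_cancel_right _ (inv_mem q.1.2)).trans (Subgroup.mul_mem_cancel_left _ q.1.2)
    by_cases hq : z * (q.2 : GL (Fin N) (w.1.adicCompletion E)) ∈ glInt N (w.1.adicCompletion E)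
    · rw [Set.indicator_of_mem (hiff.2 hq), Set.indicator_of_mem
        (s := {u : ↥(unipotentRadicalGL (w.1.adicCompletion E) c') |
          z * (u : GL (Fin N) (w.1.adicCompletion E)) ∈ glInt N (w.1.adicCompletion E)}) hq]
    · rw [Set.indicator_of_notMem (fun h => hq (hiff.1 h)), Set.indicator_of_notMem
        (s := {u : ↥(unipotentRadicalGL (w.1.adicCompletion E) c') |
          z * (u : GL (Fin N) (w.1.adicCompletion E)) ∈ glInt N (w.1.adicCompletion E)}) hq]
  haveI : CompactSpace ↥(glInt N (w.1.adicCompletion E)) :=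
    isCompact_iff_compactSpace.1 (isCompact_glInt N (w.1.adicCompletion E))
  haveI : IsFiniteMeasure κ := CompactSpace.isFiniteMeasure
  simp_rw [h1]
  rw [integral_fun_snd, measureReal_def, hκ, ENNReal.toReal_one, one_smul, integral_indicator_const _ hS,
    measureReal_def, Complex.real_smul, mul_one]

/-- **(e1′) The unramified constant at the split singular pair**: with the data and the constant `C` of
`exists_orbitalIntegral_comp_localSplitEquiv_eq_smul_of_eq_blockScalar` and `κ(K) = 1`,
`Φ^{U(J)(F_v)}_{ν/ρ}(γ₀, 1_{U(J)(𝒪_v)}) = C ‖t₂/t₁ - 1‖_w^{-|I||J|} · μ_U{u | z_t u ∈ GL_N(𝒪_w)}`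
(★ `indicator_glInt_comp_localSplitEquiv`: `1_{GL_N(𝒪_w)} ∘ e = 1_{U(J)(𝒪_v)}`); by `setOf_blockScalar_mul_mem_glInt_eq` the last factor
is `μ_U(U_{c′}(𝒪_w))` when the `t_a` are units (so `1` for the normalised `μ_U`), and `γ₀ ∉ K_v`-type vanishing is visible in it.
[cite: Rogawski1990, §4.13, Lemma 4.13.1 (a), proof p. 70] [cite: Mok2014, §1 Notation p. 5] -/
theorem exists_orbitalIntegral_indicator_eq_mul_of_eq_blockScalar (hc' : Monotone c')
    (hM : IsClosed ((standardLeviGL (w.1.adicCompletion E) c' : Subgroup (GL (Fin N) (w.1.adicCompletion E))) :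
      Set (GL (Fin N) (w.1.adicCompletion E))))
    (hJi : hJw.unit ∈ glInt N (w.1.adicCompletion E)) (hν' : ν' (glInt N (w.1.adicCompletion E)) = 1)
    (hκ : κ univ = 1) [SFinite μU] :
    ∃ C : ℝ≥0, C ≠ 0 ∧ ∀ (γ₀ : «local» E c N J v) (t : Bool → (w.1.adicCompletion E)ˣ)
      (ht : (t false : w.1.adicCompletion E) ≠ t true)
      (hγ₀ : localSplitEquiv c J hc hJ w hw hJw γ₀ =
        blockDiagonalGL (w.1.adicCompletion E) c' (fun a => Matrix.GeneralLinearGroup.scalar _ (t a)))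
      [MeasurableSpace (↥(«local» E c N J v) ⧸ Subgroup.centralizer ({γ₀} : Set («local» E c N J v)))]
      [BorelSpace (↥(«local» E c N J v) ⧸ Subgroup.centralizer ({γ₀} : Set («local» E c N J v)))]
      (hC : IsClosed ((Subgroup.centralizer ({γ₀} : Set («local» E c N J v)) : Subgroup («local» E c N J v)) :
        Set («local» E c N J v)))
      (ρ : Measure (Subgroup.centralizer ({γ₀} : Set («local» E c N J v)))) [ρ.IsMulLeftInvariant]
      [IsFiniteMeasureOnCompacts ρ] [ρ.IsOpenPosMeasure] [ρ.IsInvInvariant] [SFinite ρ]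
      (_ : ρM = Measure.map (subgroupCongrHomeomorph (localSplitEquiv c J hc hJ w hw hJw).toMulEquiv _ _
        (forall_localSplitEquiv_mem_standardLeviGL_iff c N J hc hJ w hw hJw t ht hγ₀)
        (localSplitEquiv c J hc hJ w hw hJw).continuous (localSplitEquiv c J hc hJ w hw hJw).symm.continuous) ρ)
      (ν : Measure («local» E c N J v)) [IsHaarMeasure ν] [ν.IsMulRightInvariant]
      (_ : ν (localIntegralLevel c N J v) = 1),
      orbitalIntegral γ₀ ((localIntegralLevel c N J v : Set («local» E c N J v)).indicator fun _ => (1 : ℂ))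
          (quotientMeasure (Subgroup.centralizer ({γ₀} : Set («local» E c N J v))) ρ hC ν) =
        (((C * normAbs (w.1.adicCompletion E)
            (((t true : w.1.adicCompletion E) * (t false : w.1.adicCompletion E)⁻¹ - 1) ^
              (Fintype.card {i : Fin N // c' i = false} * Fintype.card {j : Fin N // c' j = true}))⁻¹ : ℝ≥0) : ℝ) : ℂ) *
          ((μU {u : ↥(unipotentRadicalGL (w.1.adicCompletion E) c') |
              blockDiagonalGL (w.1.adicCompletion E) c' (fun a => Matrix.GeneralLinearGroup.scalar _ (t a)) *
                (u : GL (Fin N) (w.1.adicCompletion E)) ∈ glInt N (w.1.adicCompletion E)}).toReal : ℂ) := by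
  obtain ⟨C, hC0, h⟩ := exists_orbitalIntegral_comp_localSplitEquiv_eq_smul_of_eq_blockScalar c N J hc hJ w hw hJw
    ρM ν' κ μU hc' hM hJi hν' (B := ℂ)
  refine ⟨C, hC0, fun γ₀ t ht hγ₀ _ _ hCl ρ _ _ _ _ _ hρ ν _ _ hν => ?_⟩
  have hclo : IsClopen (glInt N (w.1.adicCompletion E) : Set (GL (Fin N) (w.1.adicCompletion E))) :=
    ⟨(isCompact_glInt N (w.1.adicCompletion E)).isClosed, isOpen_glInt N (w.1.adicCompletion E)⟩
  have hmain := h γ₀ t ht hγ₀ hCl ρ hρ ν hν _ (hclo.continuous_indicator (continuous_const (y := (1 : ℂ))))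
  rw [indicator_glInt_comp_localSplitEquiv c N J hc hJ w hw hJw hJi, integral_prod_indicator_glInt_conj_eq N w κ μU _ hκ,
    Complex.real_smul] at hmain
  exact hmain

end Descent

/-! ### (e3) The quotient by the `H`-side central integral -/

/-- **(e3) The split singular pair, `G`-side over `H`-side.** With the `G`-side data of
`exists_orbitalIntegral_indicator_eq_mul_of_eq_blockScalar` (canonical GL-side measures, `C` the ★ D-S1b constant) and, on the
`H`-side, ANY locally compact group `G_H` (e.g. the tree's `H_v = U(J₂)_v × U(J₁)_v`), a CENTRAL `γ₀^H ∈ K_H` and the canonical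
measure `ν_H/ρ_H` normalised by `ν_H(K_H) = 1 = ρ_H(C(γ₀^H) ∩ K_H)`:
`Φ^{G_v}(γ₀, 1_{K_v}) / Φ^{H_v}(γ₀^H, 1_{K_H}) = C ‖t₂/t₁ - 1‖_w^{-|I||J|} · μ_U{u | z_t u ∈ GL_N(𝒪_w)}` — every constant visible;
NO claim is made that this quotient is a transfer factor. [cite: Rogawski1990, §4.13, Lemma 4.13.1 (a), proof p. 70] -/
theorem exists_orbitalIntegral_indicator_div_central_eq
    [MeasurableSpace (w.1.adicCompletion E)] [BorelSpace (w.1.adicCompletion E)]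
    [MeasurableSpace («local» E c N J v)] [BorelSpace («local» E c N J v)]
    [MeasurableSpace (GL (Fin N) (w.1.adicCompletion E))] [BorelSpace (GL (Fin N) (w.1.adicCompletion E))]
    [LocallyCompactSpace (GL (Fin N) (w.1.adicCompletion E))] [SecondCountableTopology (GL (Fin N) (w.1.adicCompletion E))]
    [MeasurableSpace (GL (Fin N) (w.1.adicCompletion E) ⧸ standardLeviGL (w.1.adicCompletion E) c')]
    [BorelSpace (GL (Fin N) (w.1.adicCompletion E) ⧸ standardLeviGL (w.1.adicCompletion E) c')]
    (ρM : Measure ↥(standardLeviGL (w.1.adicCompletion E) c')) [ρM.IsMulLeftInvariant] [IsFiniteMeasureOnCompacts ρM]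
    [ρM.IsOpenPosMeasure] [ρM.IsInvInvariant] [SFinite ρM]
    (ν' : Measure (GL (Fin N) (w.1.adicCompletion E))) [IsHaarMeasure ν'] [ν'.IsMulRightInvariant]
    (κ : Measure ↥(glInt N (w.1.adicCompletion E))) [IsHaarMeasure κ]
    (μU : Measure ↥(unipotentRadicalGL (w.1.adicCompletion E) c')) [IsHaarMeasure μU] [SFinite μU] (hc' : Monotone c')
    (hM : IsClosed ((standardLeviGL (w.1.adicCompletion E) c' : Subgroup (GL (Fin N) (w.1.adicCompletion E))) :
      Set (GL (Fin N) (w.1.adicCompletion E))))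
    (hJi : hJw.unit ∈ glInt N (w.1.adicCompletion E)) (hν' : ν' (glInt N (w.1.adicCompletion E)) = 1)
    (hκ : κ univ = 1) :
    ∃ C : ℝ≥0, C ≠ 0 ∧ ∀ (γ₀ : «local» E c N J v) (t : Bool → (w.1.adicCompletion E)ˣ)
      (ht : (t false : w.1.adicCompletion E) ≠ t true)
      (hγ₀ : localSplitEquiv c J hc hJ w hw hJw γ₀ =
        blockDiagonalGL (w.1.adicCompletion E) c' (fun a => Matrix.GeneralLinearGroup.scalar _ (t a)))
      [MeasurableSpace (↥(«local» E c N J v) ⧸ Subgroup.centralizer ({γ₀} : Set («local» E c N J v)))]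
      [BorelSpace (↥(«local» E c N J v) ⧸ Subgroup.centralizer ({γ₀} : Set («local» E c N J v)))]
      (hC : IsClosed ((Subgroup.centralizer ({γ₀} : Set («local» E c N J v)) : Subgroup («local» E c N J v)) :
        Set («local» E c N J v)))
      (ρ : Measure (Subgroup.centralizer ({γ₀} : Set («local» E c N J v)))) [ρ.IsMulLeftInvariant]
      [IsFiniteMeasureOnCompacts ρ] [ρ.IsOpenPosMeasure] [ρ.IsInvInvariant] [SFinite ρ]
      (_ : ρM = Measure.map (subgroupCongrHomeomorph (localSplitEquiv c J hc hJ w hw hJw).toMulEquiv _ _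
        (forall_localSplitEquiv_mem_standardLeviGL_iff c N J hc hJ w hw hJw t ht hγ₀)
        (localSplitEquiv c J hc hJ w hw hJw).continuous (localSplitEquiv c J hc hJ w hw hJw).symm.continuous) ρ)
      (ν : Measure («local» E c N J v)) [IsHaarMeasure ν] [ν.IsMulRightInvariant]
      (_ : ν (localIntegralLevel c N J v) = 1)
      -- the `H` side: any locally compact group, a central element in the integral level, normalised measures
      (GH : Type) [Group GH] [TopologicalSpace GH] [IsTopologicalGroup GH] [LocallyCompactSpace GH]
      [SecondCountableTopology GH] [T2Space GH] [MeasurableSpace GH] [BorelSpace GH] (γH : GH)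
      (_ : ∀ g : GH, g * γH * g⁻¹ = γH)
      [MeasurableSpace (GH ⧸ Subgroup.centralizer ({γH} : Set GH))] [BorelSpace (GH ⧸ Subgroup.centralizer ({γH} : Set GH))]
      (hCH : IsClosed ((Subgroup.centralizer ({γH} : Set GH) : Subgroup GH) : Set GH))
      (ρH : Measure (Subgroup.centralizer ({γH} : Set GH))) [ρH.IsMulLeftInvariant] [IsFiniteMeasureOnCompacts ρH]
      [ρH.IsOpenPosMeasure] [ρH.IsInvInvariant]
      (νH : Measure GH) [IsHaarMeasure νH] [νH.IsMulRightInvariant] (KH : Set GH) (_ : MeasurableSet KH) (_ : γH ∈ KH)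
      (_ : νH KH = 1) (_ : ρH {h : Subgroup.centralizer ({γH} : Set GH) | (h : GH) ∈ KH} = 1),
      orbitalIntegral γ₀ ((localIntegralLevel c N J v : Set («local» E c N J v)).indicator fun _ => (1 : ℂ))
            (quotientMeasure (Subgroup.centralizer ({γ₀} : Set («local» E c N J v))) ρ hC ν) /
          orbitalIntegral γH (KH.indicator fun _ => (1 : ℂ))
            (quotientMeasure (Subgroup.centralizer ({γH} : Set GH)) ρH hCH νH) =
        (((C * normAbs (w.1.adicCompletion E)
            (((t true : w.1.adicCompletion E) * (t false : w.1.adicCompletion E)⁻¹ - 1) ^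
              (Fintype.card {i : Fin N // c' i = false} * Fintype.card {j : Fin N // c' j = true}))⁻¹ : ℝ≥0) : ℝ) : ℂ) *
          ((μU {u : ↥(unipotentRadicalGL (w.1.adicCompletion E) c') |
              blockDiagonalGL (w.1.adicCompletion E) c' (fun a => Matrix.GeneralLinearGroup.scalar _ (t a)) *
                (u : GL (Fin N) (w.1.adicCompletion E)) ∈ glInt N (w.1.adicCompletion E)}).toReal : ℂ) := by
  obtain ⟨C, hC0, h⟩ := exists_orbitalIntegral_indicator_eq_mul_of_eq_blockScalar c N J hc hJ w hw hJw
    ρM ν' κ μU hc' hM hJi hν' hκ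
  refine ⟨C, hC0, fun γ₀ t ht hγ₀ _ _ hCl ρ _ _ _ _ _ hρ ν _ _ hν GH _ _ _ _ _ _ _ _ γH hγH _ _ hCH ρH _ _ _ _ νH _ _ KH
    hKH hγK hνH hρH => ?_⟩
  rw [h γ₀ t ht hγ₀ hCl ρ hρ ν hν,
    orbitalIntegral_quotientMeasure_eq_self_of_forall_conj_eq hγH hCH ρH νH hKH hνH hρH, Set.indicator_of_mem hγK, div_one]

end Literature.NumberTheory.Automorphic.UnitaryGroup

end
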